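import Summits.Ventures.PercRepro.SixFourResidueFourPlaneLineClauses
import Summits.Ventures.PercRepro.SixFourResidueFourPlaneLineTWA
import Summits.Ventures.PercRepro.SixFourResidueFourPlaneLineTWB
import Summits.Ventures.PercRepro.SixFourResidueFourPlaneLineTWC
import Summits.Ventures.PercRepro.SixFourResidueFourPlaneLineTWD
import Summits.Ventures.PercRepro.SixFourResidueFourPlaneLineTWE
import Summits.Ventures.PercRepro.SixFourResidueFourPlaneLineTWF

/-!
# PercRepro — C-025 at `(6,4)`: THEOREM TW-100 holds — p5's `TWTable` discharged (p3, gen 11 — §21.18.7)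

p5's `TWTable` (`SixFourResidueFourPlaneLineClauses.lean`): for `13 ≤ g ≤ 100`, `n ≥ 3`, `e ∈ {0,1}`, `p = g − n ≥ 4`,
every class term `w′(g,n,s) = T⁺(g, n + s) − (12/5)·2^s − (48/5)·n` with `1 + e ≤ s ≤ p − 3` is nonnegative,
`T⁺(g,p) ≥ 0`, and the class term of the larger class of a covering pair is at least the pair charge `(12/5)·2^{n+e}`.
Here `T⁺` is p5's `Tplus` (an `inf'` over the line sizes); `Tplus4_le_Tplus` bounds it below by
`Tplus4 = C(q,2)·L(m*)/C(m*,2) − base4` through the minimiser checks of `SixFourResidueFourPlaneLineTWDefs.lean`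
(`Finset.le_inf'`), and the per-`g` decides of `TWA` … `TWF` give every cell: **`twTable_holds : TWTable`**.
-/

namespace PercRepro.SixFour

/-- `minCheckAll g` for every `13 ≤ g ≤ 100`. -/
theorem minCheckAll_of_range {g : ℕ} (hg : 13 ≤ g) (hg' : g ≤ 100) : minCheckAll g := by
  rcases (by omega : g ≤ 32 ∨ (33 ≤ g ∧ g ≤ 52) ∨ (53 ≤ g ∧ g ≤ 68) ∨ (69 ≤ g ∧ g ≤ 82) ∨ (83 ≤ g ∧ g ≤ 92) ∨ 93 ≤ g)
    with h | h | h | h | h | h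
  · exact minCheckAll_of_rangeA hg h
  · exact minCheckAll_of_rangeB h.1 h.2
  · exact minCheckAll_of_rangeC h.1 h.2
  · exact minCheckAll_of_rangeD h.1 h.2
  · exact minCheckAll_of_rangeE h.1 h.2
  · exact minCheckAll_of_rangeF h hg'

/-- `twCheckAll g` for every `13 ≤ g ≤ 100`. -/
theorem twCheckAll_of_range {g : ℕ} (hg : 13 ≤ g) (hg' : g ≤ 100) : twCheckAll g := by
  rcases (by omega : g ≤ 32 ∨ (33 ≤ g ∧ g ≤ 52) ∨ (53 ≤ g ∧ g ≤ 68) ∨ (69 ≤ g ∧ g ≤ 82) ∨ (83 ≤ g ∧ g ≤ 92) ∨ 93 ≤ g)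
    with h | h | h | h | h | h
  · exact twCheckAll_of_rangeA hg h
  · exact twCheckAll_of_rangeB h.1 h.2
  · exact twCheckAll_of_rangeC h.1 h.2
  · exact twCheckAll_of_rangeD h.1 h.2
  · exact twCheckAll_of_rangeE h.1 h.2
  · exact twCheckAll_of_rangeF h hg'

/-- The minimiser check on every cell of the table. -/
theorem minCheck_of_range {g q m : ℕ} (hg : 13 ≤ g) (hg' : g ≤ 100) (hq : 3 ≤ q) (hqg : q + 3 ≤ g) (hm : 2 ≤ m)
    (hmq : m < q) : MinCheck g q m := by
  have hc := (minCheckAll_of_range hg hg').1 q (by omega) m hmq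
  rw [Bool.or_eq_true, Bool.not_eq_true', decide_eq_false_iff_not, decide_eq_true_eq] at hc
  exact hc.resolve_left (not_not.2 ⟨hq, hqg, hm⟩)

/-- `T⁺(g,q) > 0` (integer form) on every `4 ≤ q ≤ g − 3` of the table. -/
theorem tPosCell_of_range {g q : ℕ} (hg : 13 ≤ g) (hg' : g ≤ 100) (hq : 4 ≤ q) (hqg : q + 3 ≤ g) : TPosCell g q := by
  have hc := (minCheckAll_of_range hg hg').2 q (by omega)
  rw [Bool.or_eq_true, Bool.not_eq_true', decide_eq_false_iff_not, decide_eq_true_eq] at hc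
  exact hc.resolve_left (not_not.2 ⟨hq, hqg⟩)

/-- The cell check on every cell of the table. -/
theorem twCell_of_range {g n e s : ℕ} (hg : 13 ≤ g) (hg' : g ≤ 100) (hn : 3 ≤ n) (he : e < 2) (hes : 1 + e ≤ s)
    (hq : n + s + 3 ≤ g) : TWCell g n e s := by
  have hc := twCheckAll_of_range hg hg' n (by omega) e he s (by omega)
  rw [Bool.or_eq_true, Bool.not_eq_true', decide_eq_false_iff_not, decide_eq_true_eq] at hc
  exact hc.resolve_left (not_not.2 ⟨hn, hes, hq⟩)

/-- **`μ ≤ inf'`**: when `m*` is a minimiser (`MinCheck` for every `2 ≤ m < q`), `Tplus4 g q ≤ Tplus g q`. -/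
theorem Tplus4_le_Tplus {g q : ℕ} (hg : 2 ≤ g) (hq : 3 ≤ q) (hqg : q ≤ g)
    (hmin : ∀ m, 2 ≤ m → m < q → MinCheck g q m) : Tplus4 g q ≤ Tplus g q := by
  rw [Tplus_of_three_le hq]
  unfold Tplus4
  have hC : (0 : ℚ) ≤ (q.choose 2 : ℚ) := Nat.cast_nonneg _
  have hle : muTW g q ≤ (Finset.Icc 2 (q - 1)).inf' ⟨2, by rw [Finset.mem_Icc]; omega⟩
      (fun m => Lterm4 g q m / (m.choose 2 : ℚ)) := by
    apply Finset.le_inf'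
    intro m hm
    rw [Finset.mem_Icc] at hm
    have hCm : (0 : ℚ) < (m.choose 2 : ℚ) := by
      have : 0 < m.choose 2 := Nat.choose_pos hm.1
      exact_mod_cast this
    rw [le_div_iff₀ hCm]
    exact mu_mul_le_of_minCheck hg hq hqg (by omega) (hmin m hm.1 (by omega))
  nlinarith [mul_le_mul_of_nonneg_right hle hC]

/-- **THEOREM TW-100 (§21.18.7) holds**: p5's `TWTable`. -/
theorem twTable_holds : TWTable := by
  intro g n e hg hg' hn he hng
  have hg2 : 2 ≤ g := by omega
  have hT : ∀ q, 3 ≤ q → q + 3 ≤ g → Tplus4 g q ≤ Tplus g q := fun q hq hqg =>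
    Tplus4_le_Tplus hg2 hq (by omega) (fun m hm hmq => minCheck_of_range hg hg' hq hqg hm hmq)
  refine ⟨fun s hs hsg => ?_, ?_, fun s₁ s₂ hs₁ hs₂ hs₁g hs₂g hsum hle => ?_⟩
  · have hc : TWCell g n e s := twCell_of_range hg hg' hn (by omega) (by omega) (by omega)
    have hcell := tw_of_twCell (g := g) (n := n) (e := e) (s := s) hg2 hn (by omega) (by omega) hc
    have hT' := hT (n + s) (by omega) (by omega)
    have hch : (0 : ℚ) ≤ (if g - n + e ≤ 2 * s then 12 / 5 * (2 : ℚ) ^ (n + e) else 0) := by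
      split_ifs <;> positivity
    unfold wprime
    linarith
  · have hc : TPosCell g (g - n) := tPosCell_of_range hg hg' (by omega) (by omega)
    have hpos := tpos_of_tPosCell (g := g) (p := g - n) hg2 (by omega) (by omega) hc
    have hT' := hT (g - n) (by omega) (by omega)
    linarith
  · have h2s : g - n + e ≤ 2 * s₁ := by omega
    have hc : TWCell g n e s₁ := twCell_of_range hg hg' hn (by omega) (by omega) (by omega)
    have hcell := tw_of_twCell (g := g) (n := n) (e := e) (s := s₁) hg2 hn (by omega) (by omega) hc
    rw [if_pos h2s] at hcell
    have hT' := hT (n + s₁) (by omega) (by omega)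
    unfold wprime
    linarith

end PercRepro.SixFour
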